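import Literature.Probability.Percolation.ExplorationCrossings
import Literature.Probability.LatticeModels.MedialPerturbation
import HarnessLib

/-!
# The perturbed exploration polygon at mesh `δ`: definitions

Topic: Probability / Percolation (definitions for `InterfaceTraversalBound.lean`, the
deterministic planar part and the proof of the multiple-crossing estimate
`Literature.Probability.Percolation.bondExploration_traversalBound`, Aizenman–Burchard 1999, Appendix A). For the
medial exploration path `a :: l` of a bond configuration in a discrete Dobrushin domain
(`IsMedialExploration`, `MedialInterface.lean`) this file fixes the chosen corners
`(cv i, cf i)` of its darts (primal vertex on the left, face on the right; unique by
`IsCorner.eq_of_cornerSource_eq_of_cornerTarget_eq_holds`) and defines, at mesh `δ = D.δ`, the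
**perturbed polygon** of `MedialPerturbation.lean`: the shifted source/target points
`pS i`, `pT i` of the `i`-th dart, the dart pieces `dartPiece i = [pS i, pT i]`, the connectors
`connPiece i = [pT (i-1), pS i]`, their union `pertTrace`, the stretch `subPath i₀ k` over the
darts `i₀, …, i₀ + k` as a `Path`, the side points `leftPt m = δ v_m`, `rightPt m` (the centre
of `f_m`) and the side segment `sideSeg m`, and the time bookkeeping `tIdx` (index of the dart
traversed at a given time of the polyline, capped at the last dart). All theorems about these
objects are in `InterfaceTraversalBound.lean` (Part I); here only the defining API.
-/

noncomputable section

open Set Metric Complex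
open scoped Pointwise

namespace Literature.Probability.Percolation

/-! ### Scaling helpers -/

/-- `meshPoint δ v = δ • v`. [folklore] -/
theorem meshPoint_eq_smul (δ : ℝ) (v : LatticeModels.Site 2) : LatticeModels.meshPoint δ v = δ • LatticeModels.Site.toComplex v := by
  rw [LatticeModels.meshPoint, Complex.real_smul]

/-- Scaling a segment scales its endpoints. [folklore] -/
theorem smul_segment_eq (c : ℝ) (P Q : ℂ) : c • segment ℝ P Q = segment ℝ (c • P) (c • Q) := by
  ext z
  simp only [Set.mem_smul_set, segment_eq_image', Set.mem_image]
  constructor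
  · rintro ⟨w, ⟨t, ht, rfl⟩, rfl⟩
    exact ⟨t, ht, by rw [smul_add, smul_comm c t, smul_sub c Q P]⟩
  · rintro ⟨t, ht, rfl⟩
    exact ⟨P + t • (Q - P), ⟨t, ht, rfl⟩, by rw [smul_add, smul_comm c t, smul_sub c Q P]⟩

/-- Membership in a scaled segment. [folklore] -/
theorem mem_segment_smul_iff {c : ℝ} (hc : c ≠ 0) {P Q z : ℂ} :
    z ∈ segment ℝ (c • P) (c • Q) ↔ c⁻¹ • z ∈ segment ℝ P Q := by
  rw [← smul_segment_eq, Set.mem_smul_set_iff_inv_smul_mem₀ hc]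

/-! ### The dart traversed at a given time -/

/-- The index of the dart traversed at time `u` (capped at the last dart). [folklore] -/
def tIdx (l : List LatticeModels.MedialVertex) (u : unitInterval) : ℕ := min (LatticeModels.pieceIdx l u) (l.length - 1)

/-- `tIdx` is monotone in time. [folklore] -/
theorem tIdx_mono (l : List LatticeModels.MedialVertex) {u v : unitInterval} (h : u ≤ v) : tIdx l u ≤ tIdx l v :=
  min_le_min_right _ (LatticeModels.pieceIdx_mono l h)

/-- Every index between the indices of two times is the index of an intermediate time.
[folklore] -/
theorem exists_time_of_tIdx (l : List LatticeModels.MedialVertex) {s t : unitInterval} (hst : s ≤ t) {i : ℕ}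
    (h0 : tIdx l s ≤ i) (h1 : i ≤ tIdx l t) : ∃ u : unitInterval, s ≤ u ∧ u ≤ t ∧ tIdx l u = i :=
  exists_time_of_index l hst h0 h1


section IsMedialExploration
open Literature.Probability.LatticeModels (IsMedialExploration)
open Literature.Probability.LatticeModels.IsMedialExploration

variable {D : LatticeModels.DiscreteDobrushin} {ω : BondConfig (LatticeModels.Site 2)} {a : LatticeModels.MedialVertex}
  {l : List LatticeModels.MedialVertex}

/-! ### Corners, shifted points, pieces -/

/-- The number of darts of the path `a :: l` is `l.length`. [folklore] -/
theorem _root_.Literature.Probability.LatticeModels.IsMedialExploration.length_zip (a : LatticeModels.MedialVertex) (l : List LatticeModels.MedialVertex) : ((a :: l).zip l).length = l.length := by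
  simp

/-- The primal vertex (on the left) of the `i`-th dart of the exploration path (junk `0` past
the end). (Smirnov 2001, §2.) [cite: Smirnov2001, §2] -/
def _root_.Literature.Probability.LatticeModels.IsMedialExploration.cv (hexp : IsMedialExploration D ω (a :: l)) (i : ℕ) : LatticeModels.Site 2 :=
  if hi : i < ((a :: l).zip l).length then (hexp.exists_corner_getElem i hi).choose else 0

/-- The face (on the right) of the `i`-th dart of the exploration path (junk `0` past the end).
(Smirnov 2001, §2.) [cite: Smirnov2001, §2] -/
def _root_.Literature.Probability.LatticeModels.IsMedialExploration.cf (hexp : IsMedialExploration D ω (a :: l)) (i : ℕ) : LatticeModels.Site 2 :=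
  if hi : i < ((a :: l).zip l).length then (hexp.exists_corner_getElem i hi).choose_spec.choose
  else 0

variable (hexp : IsMedialExploration D ω (a :: l))

/-- The defining properties of the `i`-th corner: it is a corner of an inner face carrying the
`i`-th dart. (Smirnov 2001, §2.) [cite: Smirnov2001, §2] -/
theorem _root_.Literature.Probability.LatticeModels.IsMedialExploration.corner_spec {i : ℕ} (hi : i < ((a :: l).zip l).length) :
    LatticeModels.IsCorner (hexp.cv i) (hexp.cf i) ∧ D.IsInnerFace (hexp.cf i) ∧
      LatticeModels.cornerSource (hexp.cv i) (hexp.cf i) = (((a :: l).zip l)[i]).1 ∧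
      LatticeModels.cornerTarget (hexp.cv i) (hexp.cf i) = (((a :: l).zip l)[i]).2 := by
  have h := (hexp.exists_corner_getElem i hi).choose_spec.choose_spec
  simp only [cv, cf, dif_pos hi]
  exact h

/-- The `i`-th corner is a corner. [cite: Smirnov2001, §2] -/
theorem _root_.Literature.Probability.LatticeModels.IsMedialExploration.isCorner {i : ℕ} (hi : i < ((a :: l).zip l).length) : LatticeModels.IsCorner (hexp.cv i) (hexp.cf i) :=
  (hexp.corner_spec hi).1

/-- The `i`-th face is inner. [cite: Smirnov2001, §2] -/
theorem _root_.Literature.Probability.LatticeModels.IsMedialExploration.isInnerFace {i : ℕ} (hi : i < ((a :: l).zip l).length) : D.IsInnerFace (hexp.cf i) :=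
  (hexp.corner_spec hi).2.1

/-- **Distinct positions carry distinct corners** (no medial edge is used twice). [cite: Smirnov2001, §2] -/
theorem _root_.Literature.Probability.LatticeModels.IsMedialExploration.corner_injective {i j : ℕ} (hi : i < ((a :: l).zip l).length)
    (hj : j < ((a :: l).zip l).length) (hv : hexp.cv i = hexp.cv j) (hf : hexp.cf i = hexp.cf j) :
    i = j := by
  obtain ⟨-, -, hs, ht⟩ := hexp.corner_spec hi
  obtain ⟨-, -, hs', ht'⟩ := hexp.corner_spec hj
  rw [hv, hf] at hs ht
  have heq : ((a :: l).zip l)[i] = ((a :: l).zip l)[j] :=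
    Prod.ext (hs.symm.trans hs') (ht.symm.trans ht')
  exact (hexp.nodup.getElem_inj_iff).1 heq

/-- The shifted source point of the `i`-th dart, at mesh `δ`. [folklore] -/
def _root_.Literature.Probability.LatticeModels.IsMedialExploration.pS (i : ℕ) : ℂ := D.δ • LatticeModels.dartPt (hexp.cv i) (hexp.cf i) (LatticeModels.srcDir (hexp.cv i) (hexp.cf i))

/-- The shifted target point of the `i`-th dart, at mesh `δ`. [folklore] -/
def _root_.Literature.Probability.LatticeModels.IsMedialExploration.pT (i : ℕ) : ℂ := D.δ • LatticeModels.dartPt (hexp.cv i) (hexp.cf i) (LatticeModels.tgtDir (hexp.cv i) (hexp.cf i))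

/-- The `i`-th **dart piece** of the perturbed polygon. [folklore] -/
def _root_.Literature.Probability.LatticeModels.IsMedialExploration.dartPiece (i : ℕ) : Set ℂ := segment ℝ (hexp.pS i) (hexp.pT i)

/-- The `i`-th **connector** of the perturbed polygon (between darts `i - 1` and `i`, for
`1 ≤ i`). [folklore] -/
def _root_.Literature.Probability.LatticeModels.IsMedialExploration.connPiece (i : ℕ) : Set ℂ := segment ℝ (hexp.pT (i - 1)) (hexp.pS i)

/-- The **trace of the perturbed polygon**: all dart pieces and connectors. [folklore] -/
def _root_.Literature.Probability.LatticeModels.IsMedialExploration.pertTrace : Set ℂ :=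
  (⋃ (i : ℕ) (_ : i < ((a :: l).zip l).length), hexp.dartPiece i) ∪
    ⋃ (i : ℕ) (_ : 1 ≤ i ∧ i < ((a :: l).zip l).length), hexp.connPiece i

/-- The dart piece is the scaled lattice-unit dart piece. [folklore] -/
theorem _root_.Literature.Probability.LatticeModels.IsMedialExploration.dartPiece_eq (i : ℕ) : hexp.dartPiece i = D.δ • LatticeModels.dartSeg (hexp.cv i) (hexp.cf i) := by
  rw [dartPiece, LatticeModels.dartSeg_eq_segment_src_tgt, smul_segment_eq]
  rfl

/-- Membership in the trace, unfolded. [folklore] -/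
theorem _root_.Literature.Probability.LatticeModels.IsMedialExploration.mem_pertTrace_iff {z : ℂ} : z ∈ hexp.pertTrace ↔
    (∃ i, i < ((a :: l).zip l).length ∧ z ∈ hexp.dartPiece i) ∨
      ∃ i, (1 ≤ i ∧ i < ((a :: l).zip l).length) ∧ z ∈ hexp.connPiece i := by
  simp only [pertTrace, mem_union, mem_iUnion, exists_prop]

/-- Dart pieces lie in the trace. [folklore] -/
theorem _root_.Literature.Probability.LatticeModels.IsMedialExploration.dartPiece_subset {i : ℕ} (hi : i < ((a :: l).zip l).length) : hexp.dartPiece i ⊆ hexp.pertTrace :=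
  fun _ hz => hexp.mem_pertTrace_iff.2 (Or.inl ⟨i, hi, hz⟩)

/-- Connectors lie in the trace. [folklore] -/
theorem _root_.Literature.Probability.LatticeModels.IsMedialExploration.connPiece_subset {i : ℕ} (hi1 : 1 ≤ i) (hi : i < ((a :: l).zip l).length) :
    hexp.connPiece i ⊆ hexp.pertTrace :=
  fun _ hz => hexp.mem_pertTrace_iff.2 (Or.inr ⟨i, ⟨hi1, hi⟩, hz⟩)

/-! ### Side points of a dart -/

/-- The **left point** of the `m`-th dart: its primal vertex, at mesh `δ`. [folklore] -/
def _root_.Literature.Probability.LatticeModels.IsMedialExploration.leftPt (m : ℕ) : ℂ := LatticeModels.meshPoint D.δ (hexp.cv m)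

/-- The **right point** of the `m`-th dart: the centre of its face, at mesh `δ`. [folklore] -/
def _root_.Literature.Probability.LatticeModels.IsMedialExploration.rightPt (m : ℕ) : ℂ := D.δ • LatticeModels.faceCenter (hexp.cf m)

/-- The **side segment** of the `m`-th dart, from its left point to its right point (the scaled
half-diagonal). [folklore] -/
def _root_.Literature.Probability.LatticeModels.IsMedialExploration.sideSeg (m : ℕ) : Set ℂ := segment ℝ (hexp.leftPt m) (hexp.rightPt m)

/-! ### Stretches of the perturbed polygon as paths -/

/-- **The stretch of the perturbed polygon over the darts `i₀, …, i₀ + k`**, as a path from the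
shifted source point of dart `i₀` to the shifted target point of dart `i₀ + k`: dart pieces and
connectors alternate. [folklore] -/
def _root_.Literature.Probability.LatticeModels.IsMedialExploration.subPath (i₀ : ℕ) : ∀ k : ℕ, Path (hexp.pS i₀) (hexp.pT (i₀ + k))
  | 0 => Path.segment (hexp.pS i₀) (hexp.pT i₀)
  | k + 1 => (subPath i₀ k).trans
      ((Path.segment (hexp.pT (i₀ + k)) (hexp.pS (i₀ + k + 1))).trans
        (Path.segment (hexp.pS (i₀ + k + 1)) (hexp.pT (i₀ + k + 1))))

end IsMedialExploration

end Literature.Probability.Percolation
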